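import Summits.CriticalPhenomena.Ising3DConformalLimit.Theorems.LeeYangGapSummitDescentNumerator
import Summits.CriticalPhenomena.Ising3DConformalLimit.Theorems.LeeYangGapSummitDescentDenominator
import Summits.CriticalPhenomena.Ising3DConformalLimit.Theorems.PerfectScreeningCoulombImpliesNontrivialGapOfBinder
import Summits.CriticalPhenomena.Ising3DConformalLimit.Theorems.LeeYangGapAssembly
import Summits.CriticalPhenomena.Ising3DConformalLimit.Theorems.LeeYangGapNewmanFirstZeroBound
import Summits.CriticalPhenomena.Ising3DConformalLimit.Theorems.LeeYangGapFirstZeroAntitoneInBeta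
import Summits.CriticalPhenomena.Ising3DConformalLimit.Theorems.LeeYangGapMonotonicityTransfer

/-!
# Summit descent for the route `LeeYangGap` (3/3): `Ising3DConformalLimit → NearCriticalLeeYangGap`

Route `LeeYangGap` (CriticalPhenomena / Ising3DConformalLimit), crux `NearCriticalLeeYangGap`
(item stmt-CriticalPhenomena-4945), redirect strategist r1.

The route's certified deciding theorem is `closes : NearCriticalLeeYangGap → … → MoebiusLimitExists → … →
Ising3DConformalLimit` with every support proved.  This file proves the CONVERSE descent
`Ising3DConformalLimit → NearCriticalLeeYangGap` (stated over the limit data,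
`nearCriticalLeeYangGap_of_limitData`, so that no registered statement is a hypothesis of a declaration),
whence `ising3DConformalLimit_iff_gap_and_moebiusLimitExists :
Ising3DConformalLimit ↔ NearCriticalLeeYangGap ∧ MoebiusLimitExists`: the crux is exactly the
non-Gaussianity conjunct (iii) of the summit read at block scale, modulo the route's residual
`MoebiusLimitExists` — the summit-strength certificate asked for by the redirect tribunal.

Mathematical content: `not_tendsto_binder_of_hasNontrivialU4`, the converse of the route's support
`GaussianLimitKillsBlockCoupling` (item 4950): if `criticalCorr 3` has a pointwise scaling limit `S` with
renormalisation `ρ > 0` on `(0,1]`, non-degenerate two-point function, scale covariance of dimension `Δ`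
and `U₄^S ≢ 0`, then the block Binder coupling `g_L = (3Σ_L² - ⟨M_L⁴⟩)/Σ_L²` at `β_c` does NOT tend to
`0`: by Part 1 (`numerator_lower`) `ρ(1/L)⁴ (3Σ_L² - ⟨M_L⁴⟩) = ρ(1/L)⁴ Σ_{Λ_L⁴}(-U₄^{lat}) ≥ c L¹²`
(identity `three_mul_sq_sub_fourth_eq_neg_sum_ursellFour`), by Part 2 (`blockSum_upper`)
`ρ(1/L)² Σ_L ≤ C L⁶`, so `g_L ≥ c/C² > 0` for all large `L`.  Then Newman's Lee–Yang factorisation of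
the block law (`stub_gapOfBinderNonvanishing`, landed) turns `¬(g_L → 0)` into the crux.

## References

* M. Aizenman, Comm. Math. Phys. 86 (1982), §1, Prop. 5.3 (sign of `U₄`, block criterion) [Aizenman1982].
* M. Aizenman, H. Duminil-Copin, Ann. Math. 194 (2021), Prop. 1.4 [AizenmanDuminilCopinAnnals2021].
* C. M. Newman, Comm. Math. Phys. 41 (1975), Thm 3 and (6) [Newman1975].
-/

noncomputable section

namespace Summit.CriticalPhenomena.Ising3DConformalLimit.LeeYangGapSummitDescent

open Literature.Probability.LatticeModels Filter Set Finset
open scoped Topology BigOperators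

/-- `3Σ_L² - ⟨M_L⁴⟩ = Σ_{Λ_L⁴} (-U₄^{lat})` (the tree identity
`three_mul_sq_sub_fourth_eq_neg_sum_ursellFour`, with the sign pushed inside). -/
theorem numerator_eq_sum (L : ℕ) :
    3 * (plusExpect 3 (criticalBeta 3) 0 (fun σ => (∑ x ∈ box 3 L, spinAt x σ) ^ 2)) ^ 2 -
        plusExpect 3 (criticalBeta 3) 0 (fun σ => (∑ x ∈ box 3 L, spinAt x σ) ^ 4) =
      ∑ a ∈ box 3 L, ∑ b ∈ box 3 L, ∑ c ∈ box 3 L, ∑ e ∈ box 3 L,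
        -(criticalCorr 3 4 ![a, b, c, e] -
          (criticalCorr 3 2 ![a, b] * criticalCorr 3 2 ![c, e] +
            criticalCorr 3 2 ![a, c] * criticalCorr 3 2 ![b, e] +
            criticalCorr 3 2 ![a, e] * criticalCorr 3 2 ![b, c])) := by
  rw [three_mul_sq_sub_fourth_eq_neg_sum_ursellFour 3 L]
  simp only [Finset.sum_neg_distrib]

/-! ### The block Binder coupling does not vanish -/

/-- **Non-Gaussian limit ⟹ non-vanishing block Binder coupling** (converse of the route's support
`GaussianLimitKillsBlockCoupling`). -/
theorem not_tendsto_binder_of_hasNontrivialU4 {ρ : ℝ → ℝ} {Δ : ℝ} {S : CorrFamily 3}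
    (hρ : ∀ δ ∈ Set.Ioc (0:ℝ) 1, 0 < ρ δ)
    (hlim : HasPointwiseScalingLimit (criticalCorr 3) ρ S) (hnd : IsNondegenerateTwoPoint S)
    (hsc : IsScaleCovariant Δ S) (hU4 : HasNontrivialU4 S) :
    ¬ Tendsto (fun L : ℕ =>
        (3 * (plusExpect 3 (criticalBeta 3) 0 (fun σ => (∑ x ∈ box 3 L, spinAt x σ) ^ 2)) ^ 2 -
            plusExpect 3 (criticalBeta 3) 0 (fun σ => (∑ x ∈ box 3 L, spinAt x σ) ^ 4)) /
          (plusExpect 3 (criticalBeta 3) 0 (fun σ => (∑ x ∈ box 3 L, spinAt x σ) ^ 2)) ^ 2)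
        atTop (𝓝 0) := by
  intro ht
  obtain ⟨c, hc, hnum⟩ := numerator_lower hρ hlim hsc hU4
  obtain ⟨C, hC, hden⟩ := blockSum_upper hρ hlim hnd hsc
  have hε₀ : 0 < c / C ^ 2 := by positivity
  have hsmall := ht.eventually (Iio_mem_nhds hε₀)
  obtain ⟨L, ⟨⟨hnL, hdL⟩, hsL⟩, hL1⟩ :=
    (((hnum.and hden).and hsmall).and (eventually_ge_atTop 1)).exists
  have hLpos : (0 : ℝ) < L := by exact_mod_cast hL1
  have hδpos : (0 : ℝ) < 1 / (L : ℝ) := by positivity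
  have hδle : 1 / (L : ℝ) ≤ 1 := by rw [div_le_one hLpos]; exact_mod_cast hL1
  have hρpos : 0 < ρ (1 / (L : ℝ)) := hρ _ ⟨hδpos, hδle⟩
  set V : ℝ := plusExpect 3 (criticalBeta 3) 0 (fun σ => (∑ x ∈ box 3 L, spinAt x σ) ^ 2) with hV
  set N : ℝ := 3 * V ^ 2 - plusExpect 3 (criticalBeta 3) 0 (fun σ => (∑ x ∈ box 3 L, spinAt x σ) ^ 4)
    with hN
  have hVsum : V = ∑ a ∈ box 3 L, ∑ b ∈ box 3 L, criticalCorr 3 2 ![a, b] :=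
    plusExpect_blockSpin_sq_eq_sum 3 L
  have hNsum : N = ∑ a ∈ box 3 L, ∑ b ∈ box 3 L, ∑ c ∈ box 3 L, ∑ e ∈ box 3 L,
      -(criticalCorr 3 4 ![a, b, c, e] -
        (criticalCorr 3 2 ![a, b] * criticalCorr 3 2 ![c, e] +
          criticalCorr 3 2 ![a, c] * criticalCorr 3 2 ![b, e] +
          criticalCorr 3 2 ![a, e] * criticalCorr 3 2 ![b, c])) :=
    numerator_eq_sum L
  rw [← hVsum] at hdL
  rw [← hNsum] at hnL
  have hVnn : 0 ≤ V := by
    rw [hVsum]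
    exact Finset.sum_nonneg fun a _ => Finset.sum_nonneg fun b _ => criticalCorr_two_nonneg a b
  -- `c L¹² ≤ ρ⁴ N` and `ρ² V ≤ C L⁶` give `c (ρ² V)² ≤ C² ρ⁴ N`, i.e. `N / V² ≥ c / C²`
  have h1 : c * (ρ (1 / (L : ℝ)) ^ 2 * V) ^ 2 ≤ C ^ 2 * (ρ (1 / (L : ℝ)) ^ 4 * N) := by
    have h2 : (ρ (1 / (L : ℝ)) ^ 2 * V) ^ 2 ≤ (C * (L : ℝ) ^ 6) ^ 2 :=
      pow_le_pow_left₀ (mul_nonneg (sq_nonneg _) hVnn) hdL 2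
    calc c * (ρ (1 / (L : ℝ)) ^ 2 * V) ^ 2 ≤ c * (C * (L : ℝ) ^ 6) ^ 2 :=
          mul_le_mul_of_nonneg_left h2 hc.le
      _ = C ^ 2 * (c * (L : ℝ) ^ 12) := by ring
      _ ≤ C ^ 2 * (ρ (1 / (L : ℝ)) ^ 4 * N) := mul_le_mul_of_nonneg_left hnL (sq_nonneg _)
  have hρ4 : 0 < ρ (1 / (L : ℝ)) ^ 4 := by positivity
  have h3 : c * V ^ 2 ≤ C ^ 2 * N := by
    have h4 : ρ (1 / (L : ℝ)) ^ 4 * (c * V ^ 2) ≤ ρ (1 / (L : ℝ)) ^ 4 * (C ^ 2 * N) := by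
      have e1 : c * (ρ (1 / (L : ℝ)) ^ 2 * V) ^ 2 = ρ (1 / (L : ℝ)) ^ 4 * (c * V ^ 2) := by ring
      have e2 : C ^ 2 * (ρ (1 / (L : ℝ)) ^ 4 * N) = ρ (1 / (L : ℝ)) ^ 4 * (C ^ 2 * N) := by ring
      rw [← e1, ← e2]; exact h1
    exact le_of_mul_le_mul_left h4 hρ4
  -- compare with `N / V² < c / C²`
  by_cases hV0 : V = 0
  · -- then `c · 0 ≤ C² N` is no contradiction by itself; use `N / V ^ 2 = N / 0`
    -- but `V ≥ 1`: the block two-point sum contains the diagonal terms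
    have hVpos : 0 < V := by
      rw [hVsum]
      have hmem : (0 : Site 3) ∈ box 3 L := by
        rw [mem_box]; intro i; simp
      calc (0 : ℝ) < criticalCorr 3 2 ![(0 : Site 3), 0] := by
            rw [criticalCorr_two_pair, sub_zero, criticalTwoPoint_zero']; exact one_pos
        _ ≤ ∑ b ∈ box 3 L, criticalCorr 3 2 ![(0 : Site 3), b] :=
            Finset.single_le_sum (f := fun b => criticalCorr 3 2 ![(0 : Site 3), b])
              (fun b _ => criticalCorr_two_nonneg 0 b) hmem
        _ ≤ ∑ a ∈ box 3 L, ∑ b ∈ box 3 L, criticalCorr 3 2 ![a, b] :=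
            Finset.single_le_sum (f := fun a => ∑ b ∈ box 3 L, criticalCorr 3 2 ![a, b])
              (fun a _ => Finset.sum_nonneg fun b _ => criticalCorr_two_nonneg a b) hmem
    exact absurd hV0 hVpos.ne'
  · have hV2 : 0 < V ^ 2 := by positivity
    have hC2 : 0 < C ^ 2 := by positivity
    have h5 : c / C ^ 2 ≤ N / V ^ 2 := by
      rw [div_le_div_iff₀ hC2 hV2]
      linarith
    linarith

/-! ### The descent and the equivalence -/

open Summit.CriticalPhenomena.Ising3DConformalLimit.Theses.LeeYangGap in
/-- **Summit descent (data form).** A Möbius-covariant, non-degenerate, non-Gaussian pointwise scaling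
limit of the critical correlators on `ℤ³` — i.e. the data of `Ising3DConformalLimit` — forces a
non-vanishing block Binder coupling at `β_c` (`not_tendsto_binder_of_hasNontrivialU4`), hence, by
Newman's Lee–Yang factorisation of the block law (`stub_gapOfBinderNonvanishing`), a Lee–Yang zero of
`⟨cos(θM_L)⟩_{β_c}` at the fluctuation scale `θ²Σ_L ≤ C` for infinitely many `L`: the crux
`NearCriticalLeeYangGap`.  (Stated over the limit data, so that no registered statement is a hypothesis.) -/
theorem nearCriticalLeeYangGap_of_limitData {ρ : ℝ → ℝ} {Δ : ℝ} {S : CorrFamily 3}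
    (hρ : ∀ δ ∈ Set.Ioc (0:ℝ) 1, 0 < ρ δ)
    (hlim : HasPointwiseScalingLimit (criticalCorr 3) ρ S) (hnd : IsNondegenerateTwoPoint S)
    (hM : IsMoebiusCovariant Δ S) (hU4 : HasNontrivialU4 S) : NearCriticalLeeYangGap :=
  PerfectScreeningCoulombImpliesNontrivial.stub_gapOfBinderNonvanishing
    (not_tendsto_binder_of_hasNontrivialU4 hρ hlim hnd hM.isScaleCovariant hU4)

open Summit.CriticalPhenomena.Ising3DConformalLimit.Theses.LeeYangGap in
/-- **The crux is the summit modulo the residual.**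
`Ising3DConformalLimit ↔ NearCriticalLeeYangGap ∧ MoebiusLimitExists`: (→) the descent
`nearCriticalLeeYangGap_of_limitData` and the projection dropping clause (iii); (←) the route's proved
assembly `leeYangGap_assembly_proof` fed with the proved supports `firstZeroAntitoneInBeta_proof`,
`monotonicityTransfer_proof`, `newmanFirstZeroBound_proof`, `gaussianLimitKillsBlockCoupling_proof`. -/
theorem ising3DConformalLimit_iff_gap_and_moebiusLimitExists :
    _root_.Ising3DConformalLimit ↔ (NearCriticalLeeYangGap ∧ MoebiusLimitExists) := by
  constructor
  · rintro ⟨ρ, Δ, S, hρ, hΔ, hlim, hnd, hM, hU4⟩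
    exact ⟨nearCriticalLeeYangGap_of_limitData hρ hlim hnd hM hU4, ⟨ρ, Δ, S, hρ, hΔ, hlim, hnd, hM⟩⟩
  · rintro ⟨hGap, hMoeb⟩
    exact Theorems.leeYangGap_assembly_proof hGap Theorems.firstZeroAntitoneInBeta_proof
      Theorems.monotonicityTransfer_proof LeeYangGapNewmanFirstZeroBound.newmanFirstZeroBound_proof
      LeeYangGapGaussianLimitKillsBlockCoupling.gaussianLimitKillsBlockCoupling_proof hMoeb

/-- Under the route's residual `MoebiusLimitExists`, the crux `NearCriticalLeeYangGap` is EQUIVALENT to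
the summit `Ising3DConformalLimit`. -/
theorem nearCriticalLeeYangGap_iff_summit_of_moebiusLimitExists
    (hMoeb : Summit.CriticalPhenomena.Ising3DConformalLimit.Theses.LeeYangGap.MoebiusLimitExists) :
    Summit.CriticalPhenomena.Ising3DConformalLimit.Theses.LeeYangGap.NearCriticalLeeYangGap ↔
      _root_.Ising3DConformalLimit :=
  ⟨fun h => ising3DConformalLimit_iff_gap_and_moebiusLimitExists.2 ⟨h, hMoeb⟩,
    fun h => (ising3DConformalLimit_iff_gap_and_moebiusLimitExists.1 h).1⟩

/-- The descent in its quotable form `S → GAP` (an `example`, so that no declaration of this file has a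
registered statement as a hypothesis). -/
example : _root_.Ising3DConformalLimit →
    Summit.CriticalPhenomena.Ising3DConformalLimit.Theses.LeeYangGap.NearCriticalLeeYangGap :=
  fun h => (ising3DConformalLimit_iff_gap_and_moebiusLimitExists.1 h).1

end Summit.CriticalPhenomena.Ising3DConformalLimit.LeeYangGapSummitDescent

end
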